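import Literature.Geometry.Lorentzian.BondiBartnikGap
import Literature.Geometry.Lorentzian.NearKerrCollarCore
import Literature.Geometry.Lorentzian.SoundNearKerrLeaf
import Literature.Geometry.Lorentzian.KillingHorizonShadowAlong
import Literature.Geometry.Lorentzian.CausalFutureProofs
import Literature.Geometry.Lorentzian.DeviationTolerance
import Literature.Geometry.Lorentzian.SpacetimeLocalConvergence
import Summits.FinalStateConjecture.FinalStateConjecture.Theorems.BartnikGapSettlingBondiBartnikRigidityDirectMethodDefs
import HarnessLib

/-!
# Work file — stub stub_compactnessToKerrInterior of line `direct-method-on-the-cone` (crux BondiBartnikRigidity,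
# stmt-FinalStateConjecture-10807), lead a2 — worker K3

VERDICT (report `work/stubs/stub_compactnessToKerrInterior.report.md`): **stub-misstated** on the
HYPOTHESIS side.  The registered signature is kept at the bottom with its `sorry` (not junk-provable,
not junk-refutable: report §1).  Everything above it is sorry-free:

* §Bookkeeping — `coordBox_eq_empty`, `IsNearModelBox.of_eq_empty` (degenerate boxes are free),
  `exists_isNearModelBox_of_nondegenerate` (reduction to `0 < T ∧ M 0 < R + 1`), `params_of_window`
  (crux window ⇒ EMK parameter clause), `le_of_semicontinuity` /
  `bondiBartnikGapLE_zero_of_semicontinuity` (LSC + USC + `γₙ → 0` ⇒ limit gap `≤ 0`);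
* §PinnedSound — `IsPinnedSoundNearKerrLeaf` = `IsSoundNearKerrLeaf` block + (S₆) tip pinning (the
  corrected hypothesis leaf), with `.isSoundNearKerrLeaf`, `.isNearKerrLeaf`, `.mono`;
* §Instances — `NearMinimisingInstance`, `ExactCollarInstance` (+ `.nearKerrCollarCore`), `Shadow`
  (pointed `Cᵏ_loc` subconvergence `Spacetime.LocalSubconvergence` carrying core onto core);
* §Shadowing — `NearMinimisingInstance.IsShadowed`, `NearMinimiserShadowing` (the soft package),
  `stub_compactnessToKerrInterior_pinned_of_shadowing` (CORRECTED K3 from shadowing + EMK, pure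
  logic), `stub_compactnessToKerrInterior_pinned_of_registered` (corrected K3 is a weakening of the
  registered one), `TypedNearMinimiserShadowing` + `stub_compactnessToKerrInterior_of_typedShadowing`
  (registered K3 = typed shadowing + EMK);
* §Facts — the four MISSING facts typed in tree vocabulary: (F1) `LeafCompactness`, (F2)
  `CutEnergyLSC`, (F3) `CompetitorRealisation`, (F4) `BoxTransfer`;
  `ExactCollarInstance.exactMinimiser_of_semicontinuity` (F2 ∧ F3 ⇒ limit is an exact minimiser with
  a competitor, proved), `nearMinimiserShadowing_of_facts` (F1–F4 ⇒ shadowing, proved by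
  contradiction along a failing sequence), `stub_compactnessToKerrInterior_pinned_of_facts`
  (F1–F4 ∧ EMK ⇒ corrected K3, proved).

LANDING FORM (p130340 ACCEPTED): the line's vocabulary (`coordBox`, `IsNearModelBox`, `shellSlab`,
`futureDomain`, `killingDomain`, `ExactMinimiserKerrness`) is imported from
`Theorems/BartnikGapSettlingBondiBartnikRigidityDirectMethodDefs.lean`; the namespace below is the Defs
namespace, so the registered signature elaborates unchanged.
Target (not proposed — verdict mis-stated): `Summits/FinalStateConjecture/FinalStateConjecture/Theorems/BartnikGapSettlingBondiBartnikRigidityCompactnessToKerrInterior.lean`.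
-/

noncomputable section

set_option linter.dupNamespace false

open Set Filter Function Topology TopologicalSpace
open Literature.Geometry.Lorentzian
open scoped Manifold ContDiff Topology ENNReal

namespace Summit.FinalStateConjecture.FinalStateConjecture.Theorems.BondiBartnikRigidity.DirectMethod



/-! ## Bookkeeping for K3 (all sorry-free)

(1) degenerate boxes are free and the reduction to `0 < T ∧ r₁ < r₂`; (2) the mass window of the crux
gives the parameter clause of `ExactMinimiserKerrness`; (3) the semicontinuity bookkeeping of the
direct method (LSC of the cut energy + USC of the infimum + gaps `γₙ → 0` ⇒ the limit core is an exact
minimiser, `BondiBartnikGapLE … 0`); (4) the PINNED SOUND leaf predicate under which the line's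
compactness step has a limit (report §2), with its projections; (5) the packaging
`NearMinimiserShadowing` of the soft package and the pure-logic derivations of K3 (corrected
hypothesis leaf) and of the registered K3 (from the typed packaging) out of it and
`ExactMinimiserKerrness`. -/

section Bookkeeping

universe u

variable {𝒮 : Spacetime.{u} 4} {B : ModelBackground}

/-- A coordinate box with `τ₂ ≤ τ₁` or `r₂ ≤ r₁` is empty. [folklore] -/
theorem coordBox_eq_empty (B : ModelBackground) {τ₁ τ₂ r₁ r₂ : ℝ} (h : τ₂ ≤ τ₁ ∨ r₂ ≤ r₁) :
    coordBox B τ₁ τ₂ r₁ r₂ = ∅ := by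
  ext x
  simp only [mem_coordBox, mem_empty_iff_false, iff_false]
  rintro ⟨h₁, h₂, h₃, h₄⟩
  rcases h with h | h <;> linarith

/-- **Degenerate boxes are free.** Over an EMPTY coordinate box every map is an `(ε, k)`-box inside
every `J`: smoothness and the inclusion are vacuous, a map out of an empty type is an open embedding,
and a `Cᵏ` sup norm over `∅` vanishes.  (So the conclusion of K3 has content only for `0 < T` and
`M 0 < R + 1`.) [folklore] -/
theorem IsNearModelBox.of_eq_empty {k : ℕ} {ε : ℝ≥0∞} {τ₁ τ₂ r₁ r₂ : ℝ} {J : Set 𝒮.carrier}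
    (Ψ : B.domain → 𝒮.carrier) (h : coordBox B τ₁ τ₂ r₁ r₂ = ∅) :
    IsNearModelBox 𝒮 B k ε τ₁ τ₂ r₁ r₂ J Ψ := by
  haveI : IsEmpty (coordBox B τ₁ τ₂ r₁ r₂) := Set.isEmpty_coe_sort.2 h
  refine ⟨?_, IsOpenEmbedding.of_isEmpty _, ?_, ?_⟩
  · rw [h]
    exact contMDiffOn_empty
  · rw [h, image_empty]
    exact empty_subset _
  · rw [h, image_empty]
    simp [supCkENorm]

/-- **Reduction to non-degenerate boxes**: to produce a box `{τ < t < τ + T, r₁ < r < r₂}` it suffices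
to do so when `0 < T` and `r₁ < r₂` (otherwise the box is empty and any map will do; `q` is any point
of the spacetime, used as the junk chart). [folklore] -/
theorem exists_isNearModelBox_of_nondegenerate {k : ℕ} {ε : ℝ≥0∞} {T r₁ r₂ : ℝ}
    {J : Set 𝒮.carrier} (q : 𝒮.carrier)
    (h : 0 < T → r₁ < r₂ →
      ∃ (τ : ℝ) (Ψ : B.domain → 𝒮.carrier), IsNearModelBox 𝒮 B k ε τ (τ + T) r₁ r₂ J Ψ) :
    ∃ (τ : ℝ) (Ψ : B.domain → 𝒮.carrier), IsNearModelBox 𝒮 B k ε τ (τ + T) r₁ r₂ J Ψ := by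
  by_cases hT : 0 < T
  · by_cases hr : r₁ < r₂
    · exact h hT hr
    · exact ⟨0, fun _ ↦ q, .of_eq_empty _ (coordBox_eq_empty B (Or.inr (not_lt.1 hr)))⟩
  · exact ⟨0, fun _ ↦ q, .of_eq_empty _ (coordBox_eq_empty B (Or.inl (by linarith)))⟩

/-- The crux's mass window `m₀ ≤ Mᵢ ≤ m₀⁻¹`, `|aᵢ| ≤ χ Mᵢ` with `0 < m₀`, `χ < 1` gives the parameter
clause `0 < Mᵢ`, `|aᵢ| < Mᵢ` of `ExactMinimiserKerrness`. [folklore] -/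
theorem params_of_window {χ m₀ : ℝ} (hχ : χ < 1) (hm₀ : 0 < m₀) {N : ℕ} {M a : Fin N → ℝ}
    (h : ∀ i, m₀ ≤ M i ∧ M i ≤ m₀⁻¹ ∧ |a i| ≤ χ * M i) (i : Fin N) : 0 < M i ∧ |a i| < M i := by
  obtain ⟨h₁, -, h₃⟩ := h i
  have hM : 0 < M i := hm₀.trans_le h₁
  exact ⟨hM, h₃.trans_lt (mul_lt_of_lt_one_left hM hχ)⟩

/-- **Semicontinuity bookkeeping of the direct method** (abstract form).  Along a sequence with own
energies `ownₙ n`, competitor energies `compₙ n` and gaps `γ n → 0`, if the limit's own energy `m` is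
LOWER semicontinuous (eventually every own energy of the approximants is `≥ m − η`) and the limit's
competitor energies are UPPER semicontinuously realised (each is eventually a competitor energy of the
approximants up to `η`), then `m` is below every competitor energy of the limit: the limit is an exact
minimiser.  Pure `ε`-management. [folklore] -/
theorem le_of_semicontinuity {own comp : ℝ → Prop} {ownₙ compₙ : ℕ → ℝ → Prop} {γ : ℕ → ℝ}
    (hγ : Tendsto γ atTop (𝓝 0)) {m : ℝ} (_hm : own m)
    (lsc : ∀ η : ℝ, 0 < η → ∀ᶠ n in atTop, ∀ m', ownₙ n m' → m ≤ m' + η)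
    (usc : ∀ m', comp m' → ∀ η : ℝ, 0 < η → ∀ᶠ n in atTop, ∃ m'', compₙ n m'' ∧ m'' ≤ m' + η)
    (gap : ∀ n m', compₙ n m' → ∀ η : ℝ, 0 < η → ∃ m'', ownₙ n m'' ∧ m'' ≤ m' + γ n + η) :
    ∀ m', comp m' → m ≤ m' := by
  intro m' hm'
  refine le_of_forall_pos_lt_add fun η hη ↦ ?_
  have hη4 : 0 < η / 4 := by positivity
  have hγ' : ∀ᶠ n in atTop, γ n < η / 4 := hγ.eventually (gt_mem_nhds hη4)
  obtain ⟨n, hn₁, ⟨m₁, hm₁, hm₁le⟩, hn₃⟩ := ((lsc _ hη4).and ((usc m' hm' _ hη4).and hγ')).exists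
  obtain ⟨m₂, hm₂, hm₂le⟩ := gap n m₁ hm₁ _ hη4
  have h := hn₁ m₂ hm₂
  linarith

/-- **The limit core is an exact minimiser** (instantiation of `le_of_semicontinuity`): if the cores
`C n` of vacuum Cauchy developments `𝒟 n` have Bondi–Bartnik gaps `≤ γ n → 0`, the limit core `C'`
of `𝒱` has a cut energy `m`, the cut energy is lower semicontinuous along the sequence and every
competitor mass of `C'` is asymptotically realised by competitor masses of the `C n`, then
`BondiBartnikGapLE 𝒱 C' 0` (Bartnik's infimum, Huang–Lee arXiv:2007.00593, Def. 7.8, in the route's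
Bondi form: `bondiBartnikGapLE_of_forall_le` with `γ = 0`). [cite: HuangLee2020, Def. 7.8] -/
theorem bondiBartnikGapLE_zero_of_semicontinuity
    {X' : Type u} [TopologicalSpace X'] [ChartedSpace E3 X'] [IsManifold (𝓡 3) ∞ X']
    [ConnectedSpace X'] {D' : InitialDataSet (𝓡 3) X'} {𝒱 : VacuumCauchyDevelopment D'}
    {C' : Set 𝒱.carrier}
    {X : ℕ → Type u} [∀ n, TopologicalSpace (X n)] [∀ n, ChartedSpace E3 (X n)]
    [∀ n, IsManifold (𝓡 3) ∞ (X n)] [∀ n, ConnectedSpace (X n)]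
    {D : ∀ n, InitialDataSet (𝓡 3) (X n)} {𝒟 : ∀ n, VacuumCauchyDevelopment (D n)}
    {C : ∀ n, Set (𝒟 n).carrier} {γ : ℕ → ℝ} (hγ : Tendsto γ atTop (𝓝 0))
    (hgap : ∀ n, (𝒟 n).BondiBartnikGapLE (C n) (γ n))
    {m : ℝ} (hm : 𝒱.toCauchyDevelopment.HasCutBondiMass C' m)
    (lsc : ∀ η : ℝ, 0 < η → ∀ᶠ n in atTop, ∀ m',
      (𝒟 n).toCauchyDevelopment.HasCutBondiMass (C n) m' → m ≤ m' + η)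
    (usc : ∀ m', 𝒱.IsCompetitorMass C' m' → ∀ η : ℝ, 0 < η → ∀ᶠ n in atTop, ∃ m'',
      (𝒟 n).IsCompetitorMass (C n) m'' ∧ m'' ≤ m' + η) :
    𝒱.BondiBartnikGapLE C' 0 :=
  VacuumCauchyDevelopment.bondiBartnikGapLE_of_forall_le hm fun m' hm' ↦ by
    rw [add_zero]
    exact le_of_semicontinuity hγ hm lsc usc
      (fun n m'' hm'' η hη ↦ (VacuumCauchyDevelopment.bondiBartnikGapLE_iff.1 (hgap n)) m'' hm'' η hη)
      m' hm'

end Bookkeeping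

/-! ## The pinned sound leaf predicate (report §2: the hypothesis-side repair K3 needs) -/

section PinnedSound

universe u

variable {X : Type u} [TopologicalSpace X] [ChartedSpace E3 X] [IsManifold (𝓡 3) ∞ X]
  [ConnectedSpace X] {D : InitialDataSet (𝓡 3) X}

/-- **`S` is a PINNED SOUND `(ε, k)`-near-Kerr leaf** of `𝒟` with `N` holes: the block of
`CauchyDevelopment.IsSoundNearKerrLeaf` VERBATIM (typed block + (S₁) `2Mᵢ ≤ Rᵢ`, (S₂)/(S₃) LAYER
certification of the hole and flat charts, (S₄) flat-frame tube separation, (S₅) achronal flat sheet),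
followed by (S₆) TIP PINNING: the Kerr–Schild origin event `cᵢ = (mo i).2` of each hole (a point of
its slab `{t*ᵢ = 0}`, in the common flat coordinates) lies within Euclidean distance `Rᵢ + 1` of the
tip `(1, 0, 0, 0)` of the unit hyperboloid `{x⁰ = √(1 + |x̲|²)}` of the flat chart.  Without (S₆) a
hole that is small on the unit scale may sit at flat distance `L → ∞` from the tip, where the sheet is
null to `O(L⁻²)` across the hole's whole neighbourhood (triage r2-2 (s1)); report §2 shows that along
such hypothesis leaves near-minimising instances admit focused incoming trains of total energy `≤ γ`
spoiling every Kerr box up to collar time `≍ L^{q/(1−q)}`, so that no argument on compacta of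
uniformly bounded size — in particular not the line's direct method — can produce K3's box; (S₆) (or
the tolerance-scaled flat background of triage r2-2 (E4)(b)) is the hypothesis-side restatement the
line needs.  Chart/deviation vocabulary: DHRT arXiv:2104.08222, §1; achronal sets: O'Neill 1983,
Ch. 14, p. 413.  Route-posited notion (third revision of the repaired leaf predicate), nothing is
asserted about it. [cite: DafermosHolzegelRodnianskiTaylor2021, §1] -/
def IsPinnedSoundNearKerrLeaf (𝒟 : CauchyDevelopment D) (k : ℕ) (ε : ℝ≥0∞) (N : ℕ)
    (M a : Fin N → ℝ) (S : Set 𝒟.carrier) : Prop :=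
  ∃ (R ρ : Fin N → ℝ) (mo : Fin N → lorentzGroup × E4) (r : Fin N → E4 → ℝ)
    (B : Fin N → ModelBackground) (U₀ : Opens E4) (B₀ : ModelBackground)
    (Ψ : ∀ i, (B i).domain → 𝒟.carrier) (Ψ₀ : B₀.domain → 𝒟.carrier)
    (L W : ∀ i, Set (B i).domain) (L₀ W₀ : Set B₀.domain),
    (∀ i, r i = fun x => Kerr.radius (a i) (poincareInv (mo i).1 (mo i).2 x)) ∧
    (∀ i, B i = starBackground (mo i).1 (mo i).2 (M i) (a i) (r i)) ∧
    B₀ = hypBackground U₀ ∧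
    (∀ i, L i = {x | -1 < (B i).time x.1 ∧ (B i).time x.1 < 1 ∧ (B i).radius x.1 < R i + 1} ∧
      W i = {x | 0 < (B i).time x.1 ∧ (B i).time x.1 < 1 ∧ (B i).radius x.1 ≤ R i}) ∧
    L₀ = {x | -1 < B₀.time x.1 ∧ B₀.time x.1 < 1} ∧
    W₀ = {x | 0 < B₀.time x.1 ∧ B₀.time x.1 < 1} ∧
    (∀ i, 0 < M i ∧ |a i| ≤ M i ∧ 0 < ρ i ∧ ρ i < R i) ∧
    {x : E4 | -1 < x 0 - Real.sqrt (1 + E4.spatialNorm x ^ 2) ∧ ∀ i, ρ i < r i x} ⊆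
      (U₀ : Set E4) ∧
    (∀ i, ContMDiffOn 𝓘(ℝ, E4) (𝓡 4) ∞ (Ψ i) (L i) ∧ IsOpenEmbedding ((L i).restrict (Ψ i)) ∧
      Ψ i '' L i ⊆ 𝒟.metric.causalFuture 𝒟.timeOrientation (range 𝒟.embed)) ∧
    ContMDiffOn 𝓘(ℝ, E4) (𝓡 4) ∞ Ψ₀ L₀ ∧ IsOpenEmbedding (L₀.restrict Ψ₀) ∧
    Ψ₀ '' L₀ ⊆ 𝒟.metric.causalFuture 𝒟.timeOrientation (range 𝒟.embed) ∧
    (∀ i, 𝒟.toSpacetime.truncDeviationCk (B i) (Ψ i) k (R i) 0 ≤ ε) ∧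
    𝒟.toSpacetime.deviationCk B₀ Ψ₀ k 0 ≤ ε ∧
    Pairwise (Function.onFun Disjoint fun i => Ψ i '' {x | x ∈ L i ∧ (B i).radius x.1 ≤ R i}) ∧
    (∀ i, Ψ i '' {x | (B i).time x.1 = 0 ∧ ρ i < (B i).radius x.1 ∧ (B i).radius x.1 ≤ R i} ⊆
      Ψ₀ '' L₀) ∧
    (∀ i, Ψ₀ '' {x | B₀.time x.1 = 0 ∧ ρ i < r i x.1 ∧ r i x.1 < R i} ⊆ Ψ i '' L i) ∧
    S = Ψ₀ '' B₀.timeSlab 0 ∪ ⋃ i, Ψ i '' (B i).truncTimeSlab (R i) 0 ∧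
    Ψ₀ '' W₀ ∪ ⋃ i, Ψ i '' W i ⊆ 𝒟.metric.chronologicalFuture 𝒟.timeOrientation S ∧
    𝒟.exteriorOf (Ψ₀ '' W₀ ∪ ⋃ i, Ψ i '' W i) \ (Ψ₀ '' W₀ ∪ ⋃ i, Ψ i '' W i) ⊆
      𝒟.metric.causalPast 𝒟.timeOrientation S ∧
    -- (S₁) thick honest discs
    (∀ i, 2 * M i ≤ R i) ∧
    -- (S₂) near-zone LAYER certification of the hole charts
    (∀ i, supCkENorm (Subtype.val '' {x : (B i).domain | x ∈ L i ∧ (B i).radius x.1 ≤ R i}) k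
      (𝒟.toSpacetime.deviationExtend (B i) (Ψ i)) ≤ ε) ∧
    -- (S₃) LAYER certification of the flat chart
    supCkENorm (Subtype.val '' L₀) k (𝒟.toSpacetime.deviationExtend B₀ Ψ₀) ≤ ε ∧
    -- (S₄) flat-frame tube separation
    Pairwise (Function.onFun Disjoint fun i =>
      {x : E4 | -1 < x 0 - Real.sqrt (1 + E4.spatialNorm x ^ 2) ∧
        x 0 - Real.sqrt (1 + E4.spatialNorm x ^ 2) < 1 ∧ r i x ≤ R i}) ∧
    -- (S₅) achronal flat sheet
    𝒟.metric.IsAchronal 𝒟.timeOrientation (Ψ₀ '' B₀.timeSlab 0) ∧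
    -- (S₆) TIP PINNING: the hole centres lie within `Rᵢ + 1` of the hyperboloid's tip `(1, 0̲)`
    (∀ i, ‖(mo i).2 - EuclideanSpace.single (0 : Fin 4) (1 : ℝ)‖ ≤ R i + 1)

namespace IsPinnedSoundNearKerrLeaf

variable {𝒟 : CauchyDevelopment D} {k k' : ℕ} {ε ε' : ℝ≥0∞} {N : ℕ} {M a : Fin N → ℝ}
  {S : Set 𝒟.carrier}

/-- Pinned sound leaves are sound leaves (drop (S₆); same charts).
[cite: DafermosHolzegelRodnianskiTaylor2021, §1] -/
theorem isSoundNearKerrLeaf (h : IsPinnedSoundNearKerrLeaf 𝒟 k ε N M a S) :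
    𝒟.IsSoundNearKerrLeaf k ε N M a S := by
  obtain ⟨R, ρ, mo, r, B, U₀, B₀, Ψ, Ψ₀, L, W, L₀, W₀, h1, h2, h3, h4, h5, h6, h7, h8, h9, h10, h11,
    h12, h13, h14, h15, h16, h17, h18, h19, h20, h21, h22, h23, h24, h25, -⟩ := h
  exact ⟨R, ρ, mo, r, B, U₀, B₀, Ψ, Ψ₀, L, W, L₀, W₀, h1, h2, h3, h4, h5, h6, h7, h8, h9, h10, h11,
    h12, h13, h14, h15, h16, h17, h18, h19, h20, h21, h22, h23, h24, h25⟩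

/-- Pinned sound leaves are typed leaves (the hypothesis the registered K3 consumes).
[cite: DafermosHolzegelRodnianskiTaylor2021, §1] -/
theorem isNearKerrLeaf (h : IsPinnedSoundNearKerrLeaf 𝒟 k ε N M a S) :
    𝒟.IsNearKerrLeaf k ε N M a S :=
  h.isSoundNearKerrLeaf.isNearKerrLeaf

/-- **Monotonicity in `(k, ε)`** of the pinned sound predicate (as for `IsSoundNearKerrLeaf.mono`,
(S₆) does not mention `(k, ε)`). [cite: DafermosHolzegelRodnianskiTaylor2021, §1] -/
theorem mono (h : IsPinnedSoundNearKerrLeaf 𝒟 k' ε N M a S) (hk : k ≤ k') (hε : ε ≤ ε') :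
    IsPinnedSoundNearKerrLeaf 𝒟 k ε' N M a S := by
  obtain ⟨R, ρ, mo, r, B, U₀, B₀, Ψ, Ψ₀, L, W, L₀, W₀, hr, hB, hB₀, hLW, hL₀, hW₀, hpar, hU₀, hΨ,
    hΨ₀, hΨ₀e, hΨ₀J, hdev, hdev₀, h15, h16, h17, h18, h19, h20, hS1, hS2, hS3, hS4, hS5, hS6⟩ := h
  exact ⟨R, ρ, mo, r, B, U₀, B₀, Ψ, Ψ₀, L, W, L₀, W₀, hr, hB, hB₀, hLW, hL₀, hW₀, hpar, hU₀, hΨ,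
    hΨ₀, hΨ₀e, hΨ₀J, fun i ↦ ((supCkENorm_mono_right _ hk _).trans (hdev i)).trans hε,
    ((supCkENorm_mono_right _ hk _).trans hdev₀).trans hε, h15, h16, h17, h18, h19, h20, hS1,
    fun i ↦ ((supCkENorm_mono_right _ hk _).trans (hS2 i)).trans hε,
    ((supCkENorm_mono_right _ hk _).trans hS3).trans hε, hS4, hS5, hS6⟩

end IsPinnedSoundNearKerrLeaf

end PinnedSound

/-! ## Instances, limit instances, shadows; the four facts behind `NearMinimiserShadowing` (report §3)

Sequential form.  A failing family of K3 at fixed `(χ, m₀, k', Λ)` with `δₙ, γₙ → 0` is a sequence of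
`NearMinimisingInstance`s; (F1) extracts a limit `ExactCollarInstance` together with a pointed
`Cᵏ_loc` subconvergence of the developments carrying core to core (`Shadow`); (F2)/(F3) are the two
semicontinuities, which by `bondiBartnikGapLE_zero_of_semicontinuity` make the limit an exact
minimiser with a competitor (`ExactCollarInstance.exactMinimiser_of_semicontinuity`, proved); then
`ExactMinimiserKerrness` gives exact boxes and (F4) transfers them.  All four are MISSING in the tree
(status and sources in the docstrings); nothing is asserted about them here. -/

section Instances

/-- A **near-minimising instance** of K3 (corrected hypothesis leaf) at margin/window `(χ, m₀)`,
regularity `k'`, leaf tolerance `Λ`, collar closeness `δ` and gap `γ`: an MGHD `𝒟` of admissible data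
on `X`, one hole `(M, a)` in the window, a pinned sound `(Λ, k')`-leaf `S ∋ p`, `p` in the thick
collar of the chart `Φ₀` on the background `B₀` with motion `mo₀`, and the thick-collar block
`NearKerrCollarCore k' δ γ` — the data over which K3 quantifies, bundled (so that sequences of
instances can be indexed by `ℕ`). [folklore] -/
structure NearMinimisingInstance (χ m₀ : ℝ) (k' : ℕ) (Λ δ : ℝ≥0∞) (γ : ℝ) : Type 1 where
  /-- the data manifold -/
  X : Type
  [topologicalSpace : TopologicalSpace X]
  [chartedSpace : ChartedSpace E3 X]
  [isManifold : IsManifold (𝓡 3) ∞ X]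
  [t2Space : T2Space X]
  [secondCountableTopology : SecondCountableTopology X]
  [connectedSpace : ConnectedSpace X]
  /-- the admissible datum -/
  D : InitialDataSet (𝓡 3) X
  mem_admissibleVacuumData : D ∈ admissibleVacuumData X
  /-- its maximal vacuum Cauchy development -/
  𝒟 : VacuumCauchyDevelopment D
  /-- mass and spin of the hole -/
  M : Fin 1 → ℝ
  a : Fin 1 → ℝ
  /-- the hypothesis leaf and the probe point -/
  S : Set 𝒟.carrier
  p : 𝒟.carrier
  /-- the collar chart: motion, background, chart -/
  mo : Fin 1 → lorentzGroup × E4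
  B : Fin 1 → ModelBackground
  Φ : ∀ i, (B i).domain → 𝒟.carrier
  isMaximal : 𝒟.IsMaximal
  window : ∀ i, m₀ ≤ M i ∧ M i ≤ m₀⁻¹ ∧ |a i| ≤ χ * M i
  leaf : IsPinnedSoundNearKerrLeaf 𝒟.toCauchyDevelopment k' Λ 1 M a S
  p_mem : p ∈ S
  p_mem_collar : ∃ i, p ∈ Φ i '' (B i).truncTimeSlab (3 * M i) 0
  nearKerrCollarCore : 𝒟.NearKerrCollarCore k' δ γ 1 M a S p mo B Φ

attribute [instance] NearMinimisingInstance.topologicalSpace NearMinimisingInstance.chartedSpace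
  NearMinimisingInstance.isManifold NearMinimisingInstance.t2Space
  NearMinimisingInstance.secondCountableTopology NearMinimisingInstance.connectedSpace

namespace NearMinimisingInstance

variable {χ m₀ : ℝ} {k' : ℕ} {Λ δ : ℝ≥0∞} {γ : ℝ}

/-- The core `C = {p} ∪ Φ₀({t* = 0, M < r ≤ 3M})` of the instance. [folklore] -/
def core (I : NearMinimisingInstance χ m₀ k' Λ δ γ) : Set I.𝒟.carrier :=
  collarCore I.M I.p I.B I.Φ

/-- The instance's Bondi–Bartnik gap clause (C7), in the `BondiBartnikGapLE` form (definitional).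
[cite: HuangLee2020, Def. 7.8] -/
theorem bondiBartnikGapLE (I : NearMinimisingInstance χ m₀ k' Λ δ γ) :
    I.𝒟.BondiBartnikGapLE I.core γ :=
  I.nearKerrCollarCore.2.2.2.2.2.2

end NearMinimisingInstance

/-- An instance of the **LIMIT CATEGORY with an EXACT thick collar**: a maximal vacuum Cauchy
development `𝒱` of arbitrary smooth data (any connected Hausdorff second countable `X`), one hole
with `0 < M`, `|a| < M`, `p` in the thick collar of a chart `Φ₀` whose background is the boosted Kerr
star background (C1), which is smooth and an open embedding on the collar layer (C2) and has
VANISHING `C^{k''}` deviation on the thick slab (C3 with `δ = 0`), and whose core lies ON the Cauchy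
slice — the hypotheses of `ExactMinimiserKerrness` except the cut energy, the gap and the competitor,
which the semicontinuity facts supply (`exactMinimiser_of_semicontinuity`). [folklore] -/
structure ExactCollarInstance (k'' : ℕ) : Type 1 where
  /-- the data manifold of the limit -/
  X : Type
  [topologicalSpace : TopologicalSpace X]
  [chartedSpace : ChartedSpace E3 X]
  [isManifold : IsManifold (𝓡 3) ∞ X]
  [t2Space : T2Space X]
  [secondCountableTopology : SecondCountableTopology X]
  [connectedSpace : ConnectedSpace X]
  /-- the limit datum (arbitrary smooth data) and its maximal vacuum development -/
  D : InitialDataSet (𝓡 3) X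
  𝒱 : VacuumCauchyDevelopment D
  M : Fin 1 → ℝ
  a : Fin 1 → ℝ
  p : 𝒱.carrier
  mo : Fin 1 → lorentzGroup × E4
  B : Fin 1 → ModelBackground
  Φ : ∀ i, (B i).domain → 𝒱.carrier
  isMaximal : 𝒱.IsMaximal
  params : ∀ i, 0 < M i ∧ |a i| < M i
  p_mem_collar : ∃ i, p ∈ Φ i '' (B i).truncTimeSlab (3 * M i) 0
  core_subset : collarCore M p B Φ ⊆ range 𝒱.embed
  /-- (C1) boosted Kerr star backgrounds -/
  background : ∀ i, B i = starBackground (mo i).1 (mo i).2 (M i) (a i)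
    (fun x => Kerr.radius (a i) (poincareInv (mo i).1 (mo i).2 x))
  /-- (C2) the chart is smooth on the collar layer and an open embedding of it -/
  chart : ∀ i, ContMDiffOn 𝓘(ℝ, E4) (𝓡 4) ∞ (Φ i)
      {x | -1 < (B i).time x.1 ∧ (B i).time x.1 < 1 ∧ (B i).radius x.1 < 3 * M i + 1} ∧
    IsOpenEmbedding
      ({x | -1 < (B i).time x.1 ∧ (B i).time x.1 < 1 ∧ (B i).radius x.1 < 3 * M i + 1}.restrict
        (Φ i))
  /-- (C3, `δ = 0`) EXACT `k''`-jet of boosted Kerr on the thick slab -/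
  exact : ∀ i, 𝒱.toSpacetime.truncDeviationCk (B i) (Φ i) k'' (3 * M i) 0 ≤ 0

attribute [instance] ExactCollarInstance.topologicalSpace ExactCollarInstance.chartedSpace
  ExactCollarInstance.isManifold ExactCollarInstance.t2Space
  ExactCollarInstance.secondCountableTopology ExactCollarInstance.connectedSpace

namespace ExactCollarInstance

variable {k'' : ℕ}

/-- The core of the limit instance. [folklore] -/
def core (L : ExactCollarInstance k'') : Set L.𝒱.carrier :=
  collarCore L.M L.p L.B L.Φ

/-- With a cut energy and gap `≤ 0` an exact collar instance carries the EXACT thick-collar block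
`NearKerrCollarCore k'' 0 0 1 … univ …` ((C4) is trivial against `univ`, (C5) is vacuous for one
hole). [cite: HuangLee2020, Def. 7.8] -/
theorem nearKerrCollarCore (L : ExactCollarInstance k'')
    (hmass : ∃ m : ℝ, L.𝒱.toCauchyDevelopment.HasCutBondiMass L.core m)
    (hgap : L.𝒱.BondiBartnikGapLE L.core 0) :
    L.𝒱.NearKerrCollarCore k'' 0 0 1 L.M L.a univ L.p L.mo L.B L.Φ :=
  ⟨L.background, L.chart, L.exact, fun _ ↦ subset_univ _,
    fun i j hij ↦ absurd (Subsingleton.elim i j) hij, hmass, hgap⟩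

end ExactCollarInstance

/-- A **shadow**: how a sequence of near-minimising instances `I n` is tied to a limit exact-collar
instance `L` — a pointed `Cᵏ_loc` (Cheeger–Gromov) subconvergence of the developments
(`Spacetime.LocalSubconvergence`, Petersen 2006, Ch. 10, §3.2) based at the probe points, whose
comparison maps carry the limit core ONTO the cores of the approximants, with converging hole
parameters. [cite: Petersen2006, Ch. 10 §3.2] -/
structure Shadow {χ m₀ : ℝ} {k' : ℕ} {Λ : ℝ≥0∞} {δ : ℕ → ℝ≥0∞} {γ : ℕ → ℝ}
    (I : ∀ n, NearMinimisingInstance χ m₀ k' Λ (δ n) (γ n)) {k'' : ℕ} (L : ExactCollarInstance k'')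
    (k : ℕ) where
  /-- the pointed `Cᵏ_loc` subconvergence `(𝒟ₙ, pₙ) ⇀ (𝒱, p)` -/
  cv : Spacetime.LocalSubconvergence (fun n ↦ (I n).𝒟.toSpacetime) (fun n ↦ (I n).p)
    L.𝒱.toSpacetime L.p k
  /-- the comparison maps carry the limit core onto the cores of the approximants -/
  image_core : ∀ n, cv.embed n '' L.core = (I (cv.sub n)).core
  /-- the hole parameters converge -/
  tendsto_mass : Tendsto (fun n ↦ (I (cv.sub n)).M 0) atTop (𝓝 (L.M 0))
  tendsto_spin : Tendsto (fun n ↦ (I (cv.sub n)).a 0) atTop (𝓝 (L.a 0))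

end Instances

/-! ## The soft package as one named statement, and K3 from it by pure logic -/

section Shadowing

variable {χ m₀ : ℝ} {k' : ℕ} {Λ δ : ℝ≥0∞} {γ : ℝ}

/-- The near-minimising instance `I` is **`(k₁, ε₁, R, T)`-shadowed**: some exact-collar instance `L`
of the limit category at a level `k'' ≥ 2` is an exact minimiser with a competitor (so that ALL
hypotheses of `ExactMinimiserKerrness` hold for it) and, if `L` has an exact `(0, K)`-box of radius
`R + 1` and length `T` of its own background inside `J⁺(C∞)`, then `I` has an `(ε₁, k₁)`-box of its
collar's background inside `J⁺(C)`. [folklore] -/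
def NearMinimisingInstance.IsShadowed (I : NearMinimisingInstance χ m₀ k' Λ δ γ) (k₁ : ℕ)
    (ε₁ : ℝ≥0∞) (R T : ℝ) : Prop :=
  ∃ (k'' K : ℕ) (_ : 2 ≤ k'') (L : ExactCollarInstance k''),
    L.𝒱.NearKerrCollarCore k'' 0 0 1 L.M L.a univ L.p L.mo L.B L.Φ ∧
    (∃ m' : ℝ, L.𝒱.IsCompetitorMass L.core m') ∧
    ((∃ (τ' : ℝ) (Ψ' : (L.B 0).domain → L.𝒱.carrier),
        IsNearModelBox L.𝒱.toSpacetime (L.B 0) K 0 τ' (τ' + T) (L.M 0) (R + 1)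
          (L.𝒱.metric.causalFuture L.𝒱.timeOrientation L.core) Ψ') →
      ∃ (τ : ℝ) (Ψ : (I.B 0).domain → I.𝒟.carrier),
        IsNearModelBox I.𝒟.toSpacetime (I.B 0) k₁ ε₁ τ (τ + T) (I.M 0) (R + 1)
          (I.𝒟.metric.causalFuture I.𝒟.timeOrientation I.core) Ψ)

/-- **NEAR-MINIMISER SHADOWING** (the soft package of K3 with the rigidity input removed; MISSING —
proved below from the four missing facts (F1)–(F4) by pure logic,
`nearMinimiserShadowing_of_facts`).  For every margin/window `(χ, m₀)`, box quality `(k₁, ε₁)`,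
radius `R` and length `T` there is `k'` such that below the honesty threshold some `δ, γ > 0` make
every near-minimising instance — an MGHD of admissible data, a PINNED SOUND `(Λ, k')`-leaf `S ∋ p`,
`p` in the one `δ`-Kerr thick collar, `NearKerrCollarCore k' δ γ` — `(k₁, ε₁, R, T)`-shadowed by an
exact minimiser of the limit category.  Route-posited OPEN statement (the planner's
"compactness–semicontinuity–transfer"); K3 (corrected) is
`NearMinimiserShadowing → ExactMinimiserKerrness → K3` by pure logic
(`stub_compactnessToKerrInterior_pinned_of_shadowing`). [conjecture] [folklore] -/
def NearMinimiserShadowing : Prop :=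
  ∀ (χ m₀ : ℝ) (k₁ : ℕ) (ε₁ : ℝ≥0∞) (R T : ℝ), χ < 1 → 0 < m₀ → 0 < ε₁ →
    ∃ k' : ℕ, ∀ Λ : ℝ≥0∞, Λ < 1 → ∃ (δ : ℝ≥0∞) (γ : ℝ), 0 < δ ∧ 0 < γ ∧
    ∀ I : NearMinimisingInstance χ m₀ k' Λ δ γ, I.IsShadowed k₁ ε₁ R T

/-- **K3, CORRECTED (hypothesis leaf PINNED SOUND), from the soft package and exact-minimiser
Kerrness by pure logic**: bundle the hypotheses into a `NearMinimisingInstance`; the shadowing exact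
minimiser satisfies the hypotheses of `ExactMinimiserKerrness`, which yields an exact box of radius
`R + 1` and length `T` inside its `J⁺(C∞)`; the transfer clause turns it into the `(ε₁, k₁)`-box.  The
statement proved is the CORRECTED SIGNATURE of the stub (report §2): verbatim the registered one with
`IsNearKerrLeaf` ↦ `IsPinnedSoundNearKerrLeaf`. [folklore] -/
theorem stub_compactnessToKerrInterior_pinned_of_shadowing (hS : NearMinimiserShadowing)
    (hE : ExactMinimiserKerrness) :
    ∀ (χ m₀ : ℝ) (k₁ : ℕ) (ε₁ : ℝ≥0∞) (R T : ℝ), χ < 1 → 0 < m₀ → 0 < ε₁ →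
    ∃ k' : ℕ, ∀ Λ : ℝ≥0∞, Λ < 1 → ∃ (δ : ℝ≥0∞) (γ : ℝ), 0 < δ ∧ 0 < γ ∧
    ∀ (X : Type) [TopologicalSpace X] [ChartedSpace E3 X] [IsManifold (𝓡 3) ∞ X]
      [T2Space X] [SecondCountableTopology X] [ConnectedSpace X],
    ∀ D ∈ admissibleVacuumData X, ∀ (𝒟 : VacuumCauchyDevelopment D)
      (M a : Fin 1 → ℝ) (S : Set 𝒟.carrier) (p : 𝒟.carrier) (mo : Fin 1 → lorentzGroup × E4)
      (B : Fin 1 → ModelBackground) (Φ : ∀ i, (B i).domain → 𝒟.carrier),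
    𝒟.IsMaximal → (∀ i, m₀ ≤ M i ∧ M i ≤ m₀⁻¹ ∧ |a i| ≤ χ * M i) →
    IsPinnedSoundNearKerrLeaf 𝒟.toCauchyDevelopment k' Λ 1 M a S → p ∈ S →
    (∃ i, p ∈ Φ i '' (B i).truncTimeSlab (3 * M i) 0) →
    𝒟.NearKerrCollarCore k' δ γ 1 M a S p mo B Φ →
    ∃ (τ : ℝ) (Ψ : (B 0).domain → 𝒟.carrier),
      IsNearModelBox 𝒟.toSpacetime (B 0) k₁ ε₁ τ (τ + T) (M 0) (R + 1)
        (𝒟.metric.causalFuture 𝒟.timeOrientation (collarCore M p B Φ)) Ψ := by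
  intro χ m₀ k₁ ε₁ R T hχ hm₀ hε₁
  obtain ⟨k', hk'⟩ := hS χ m₀ k₁ ε₁ R T hχ hm₀ hε₁
  refine ⟨k', fun Λ hΛ ↦ ?_⟩
  obtain ⟨δ, γ, hδ, hγ, h⟩ := hk' Λ hΛ
  refine ⟨δ, γ, hδ, hγ, ?_⟩
  intro X _ _ _ _ _ _ D hD 𝒟 M a S p mo B Φ hmax hwin hleaf hp hpc hcore
  obtain ⟨k'', K, hk'', L, hcore', hcomp', htransfer⟩ :=
    h ⟨X, D, hD, 𝒟, M, a, S, p, mo, B, Φ, hmax, hwin, hleaf, hp, hpc, hcore⟩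
  exact htransfer (hE k'' hk'' L.X L.D L.𝒱 L.M L.a L.p L.mo L.B L.Φ L.isMaximal L.params
    L.p_mem_collar L.core_subset hcore' hcomp' K R T)

/-- The corrected K3 is a WEAKENING of the registered one (pinned sound leaves are typed leaves,
`IsPinnedSoundNearKerrLeaf.isNearKerrLeaf`), so the reshaped skeleton loses nothing already proved:
the registered statement implies the corrected one. [folklore] -/
theorem stub_compactnessToKerrInterior_pinned_of_registered
    (h : ExactMinimiserKerrness →
      ∀ (χ m₀ : ℝ) (k₁ : ℕ) (ε₁ : ℝ≥0∞) (R T : ℝ), χ < 1 → 0 < m₀ → 0 < ε₁ →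
      ∃ k' : ℕ, ∀ Λ : ℝ≥0∞, Λ < 1 → ∃ (δ : ℝ≥0∞) (γ : ℝ), 0 < δ ∧ 0 < γ ∧
      ∀ (X : Type) [TopologicalSpace X] [ChartedSpace E3 X] [IsManifold (𝓡 3) ∞ X]
        [T2Space X] [SecondCountableTopology X] [ConnectedSpace X],
      ∀ D ∈ admissibleVacuumData X, ∀ (𝒟 : VacuumCauchyDevelopment D)
        (M a : Fin 1 → ℝ) (S : Set 𝒟.carrier) (p : 𝒟.carrier) (mo : Fin 1 → lorentzGroup × E4)
        (B : Fin 1 → ModelBackground) (Φ : ∀ i, (B i).domain → 𝒟.carrier),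
      𝒟.IsMaximal → (∀ i, m₀ ≤ M i ∧ M i ≤ m₀⁻¹ ∧ |a i| ≤ χ * M i) →
      𝒟.toCauchyDevelopment.IsNearKerrLeaf k' Λ 1 M a S → p ∈ S →
      (∃ i, p ∈ Φ i '' (B i).truncTimeSlab (3 * M i) 0) →
      𝒟.NearKerrCollarCore k' δ γ 1 M a S p mo B Φ →
      ∃ (τ : ℝ) (Ψ : (B 0).domain → 𝒟.carrier),
        IsNearModelBox 𝒟.toSpacetime (B 0) k₁ ε₁ τ (τ + T) (M 0) (R + 1)
          (𝒟.metric.causalFuture 𝒟.timeOrientation (collarCore M p B Φ)) Ψ)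
    (hE : ExactMinimiserKerrness) :
    ∀ (χ m₀ : ℝ) (k₁ : ℕ) (ε₁ : ℝ≥0∞) (R T : ℝ), χ < 1 → 0 < m₀ → 0 < ε₁ →
    ∃ k' : ℕ, ∀ Λ : ℝ≥0∞, Λ < 1 → ∃ (δ : ℝ≥0∞) (γ : ℝ), 0 < δ ∧ 0 < γ ∧
    ∀ (X : Type) [TopologicalSpace X] [ChartedSpace E3 X] [IsManifold (𝓡 3) ∞ X]
      [T2Space X] [SecondCountableTopology X] [ConnectedSpace X],
    ∀ D ∈ admissibleVacuumData X, ∀ (𝒟 : VacuumCauchyDevelopment D)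
      (M a : Fin 1 → ℝ) (S : Set 𝒟.carrier) (p : 𝒟.carrier) (mo : Fin 1 → lorentzGroup × E4)
      (B : Fin 1 → ModelBackground) (Φ : ∀ i, (B i).domain → 𝒟.carrier),
    𝒟.IsMaximal → (∀ i, m₀ ≤ M i ∧ M i ≤ m₀⁻¹ ∧ |a i| ≤ χ * M i) →
    IsPinnedSoundNearKerrLeaf 𝒟.toCauchyDevelopment k' Λ 1 M a S → p ∈ S →
    (∃ i, p ∈ Φ i '' (B i).truncTimeSlab (3 * M i) 0) →
    𝒟.NearKerrCollarCore k' δ γ 1 M a S p mo B Φ →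
    ∃ (τ : ℝ) (Ψ : (B 0).domain → 𝒟.carrier),
      IsNearModelBox 𝒟.toSpacetime (B 0) k₁ ε₁ τ (τ + T) (M 0) (R + 1)
        (𝒟.metric.causalFuture 𝒟.timeOrientation (collarCore M p B Φ)) Ψ := by
  intro χ m₀ k₁ ε₁ R T hχ hm₀ hε₁
  obtain ⟨k', hk'⟩ := h hE χ m₀ k₁ ε₁ R T hχ hm₀ hε₁
  refine ⟨k', fun Λ hΛ ↦ ?_⟩
  obtain ⟨δ, γ, hδ, hγ, h'⟩ := hk' Λ hΛ
  exact ⟨δ, γ, hδ, hγ, fun X _ _ _ _ _ _ D hD 𝒟 M a S p mo B Φ hmax hwin hleaf ↦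
    h' X D hD 𝒟 M a S p mo B Φ hmax hwin hleaf.isNearKerrLeaf⟩

/-- **TYPED shadowing** — the same packaging with the REGISTERED (typed) hypothesis leaf
`IsNearKerrLeaf` (raw form; no facts of this file deliver it).  Report §2: for `m₀ < Λ/4` the typed
(indeed the unpinned sound) hypothesis admits far-tipped sheets along which the quiet epoch of
near-minimising instances recedes without bound, so this statement is NOT reachable by any argument on
compacta of uniform size; it is recorded only to show that the registered K3 is, by pure logic,
`TypedNearMinimiserShadowing → ExactMinimiserKerrness → K3`
(`stub_compactnessToKerrInterior_of_typedShadowing`): all of K3's content beyond rigidity sits in this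
one (doubtful as typed) statement. [conjecture] [folklore] -/
def TypedNearMinimiserShadowing : Prop :=
  ∀ (χ m₀ : ℝ) (k₁ : ℕ) (ε₁ : ℝ≥0∞) (R T : ℝ), χ < 1 → 0 < m₀ → 0 < ε₁ →
    ∃ k' : ℕ, ∀ Λ : ℝ≥0∞, Λ < 1 → ∃ (δ : ℝ≥0∞) (γ : ℝ), 0 < δ ∧ 0 < γ ∧
    ∀ (X : Type) [TopologicalSpace X] [ChartedSpace E3 X] [IsManifold (𝓡 3) ∞ X]
      [T2Space X] [SecondCountableTopology X] [ConnectedSpace X],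
    ∀ D ∈ admissibleVacuumData X, ∀ (𝒟 : VacuumCauchyDevelopment D)
      (M a : Fin 1 → ℝ) (S : Set 𝒟.carrier) (p : 𝒟.carrier) (mo : Fin 1 → lorentzGroup × E4)
      (B : Fin 1 → ModelBackground) (Φ : ∀ i, (B i).domain → 𝒟.carrier),
    𝒟.IsMaximal → (∀ i, m₀ ≤ M i ∧ M i ≤ m₀⁻¹ ∧ |a i| ≤ χ * M i) →
    𝒟.toCauchyDevelopment.IsNearKerrLeaf k' Λ 1 M a S → p ∈ S →
    (∃ i, p ∈ Φ i '' (B i).truncTimeSlab (3 * M i) 0) →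
    𝒟.NearKerrCollarCore k' δ γ 1 M a S p mo B Φ →
    ∃ (k'' K : ℕ) (_ : 2 ≤ k'') (L : ExactCollarInstance k''),
      L.𝒱.NearKerrCollarCore k'' 0 0 1 L.M L.a univ L.p L.mo L.B L.Φ ∧
      (∃ m' : ℝ, L.𝒱.IsCompetitorMass L.core m') ∧
      ((∃ (τ' : ℝ) (Ψ' : (L.B 0).domain → L.𝒱.carrier),
          IsNearModelBox L.𝒱.toSpacetime (L.B 0) K 0 τ' (τ' + T) (L.M 0) (R + 1)
            (L.𝒱.metric.causalFuture L.𝒱.timeOrientation L.core) Ψ') →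
        ∃ (τ : ℝ) (Ψ : (B 0).domain → 𝒟.carrier),
          IsNearModelBox 𝒟.toSpacetime (B 0) k₁ ε₁ τ (τ + T) (M 0) (R + 1)
            (𝒟.metric.causalFuture 𝒟.timeOrientation (collarCore M p B Φ)) Ψ)

/-- **The REGISTERED K3 from typed shadowing and exact-minimiser Kerrness** (pure logic; see the
docstring of `TypedNearMinimiserShadowing` for why the typed packaging is not expected to be provable
along the line). [folklore] -/
theorem stub_compactnessToKerrInterior_of_typedShadowing (hS : TypedNearMinimiserShadowing)
    (hE : ExactMinimiserKerrness) :
    ∀ (χ m₀ : ℝ) (k₁ : ℕ) (ε₁ : ℝ≥0∞) (R T : ℝ), χ < 1 → 0 < m₀ → 0 < ε₁ →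
    ∃ k' : ℕ, ∀ Λ : ℝ≥0∞, Λ < 1 → ∃ (δ : ℝ≥0∞) (γ : ℝ), 0 < δ ∧ 0 < γ ∧
    ∀ (X : Type) [TopologicalSpace X] [ChartedSpace E3 X] [IsManifold (𝓡 3) ∞ X]
      [T2Space X] [SecondCountableTopology X] [ConnectedSpace X],
    ∀ D ∈ admissibleVacuumData X, ∀ (𝒟 : VacuumCauchyDevelopment D)
      (M a : Fin 1 → ℝ) (S : Set 𝒟.carrier) (p : 𝒟.carrier) (mo : Fin 1 → lorentzGroup × E4)
      (B : Fin 1 → ModelBackground) (Φ : ∀ i, (B i).domain → 𝒟.carrier),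
    𝒟.IsMaximal → (∀ i, m₀ ≤ M i ∧ M i ≤ m₀⁻¹ ∧ |a i| ≤ χ * M i) →
    𝒟.toCauchyDevelopment.IsNearKerrLeaf k' Λ 1 M a S → p ∈ S →
    (∃ i, p ∈ Φ i '' (B i).truncTimeSlab (3 * M i) 0) →
    𝒟.NearKerrCollarCore k' δ γ 1 M a S p mo B Φ →
    ∃ (τ : ℝ) (Ψ : (B 0).domain → 𝒟.carrier),
      IsNearModelBox 𝒟.toSpacetime (B 0) k₁ ε₁ τ (τ + T) (M 0) (R + 1)
        (𝒟.metric.causalFuture 𝒟.timeOrientation (collarCore M p B Φ)) Ψ := by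
  intro χ m₀ k₁ ε₁ R T hχ hm₀ hε₁
  obtain ⟨k', hk'⟩ := hS χ m₀ k₁ ε₁ R T hχ hm₀ hε₁
  refine ⟨k', fun Λ hΛ ↦ ?_⟩
  obtain ⟨δ, γ, hδ, hγ, h⟩ := hk' Λ hΛ
  refine ⟨δ, γ, hδ, hγ, ?_⟩
  intro X _ _ _ _ _ _ D hD 𝒟 M a S p mo B Φ hmax hwin hleaf hp hpc hcore
  obtain ⟨k'', K, hk'', L, hcore', hcomp', htransfer⟩ :=
    h X D hD 𝒟 M a S p mo B Φ hmax hwin hleaf hp hpc hcore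
  exact htransfer (hE k'' hk'' L.X L.D L.𝒱 L.M L.a L.p L.mo L.B L.Φ L.isMaximal L.params
    L.p_mem_collar L.core_subset hcore' hcomp' K R T)

end Shadowing

/-! ## The four missing facts (F1)–(F4), typed; the soft package and the corrected K3 from them -/

section Facts

/-- **(F1) LEAF-DATA COMPACTNESS + CAUCHY STABILITY** (MISSING).  For every margin/window and
requested convergence order `k` there is `k'` (derivative loss) such that below the honesty threshold
every sequence of near-minimising instances with `δₙ → 0` has a limit exact-collar instance at level
`k + 2` shadowing a subsequence in `Cᵏ_loc`.  Route: Arzelà–Ascoli on the FIXED model domains of the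
pinned sound leaf charts (collar layer, near-zone layer, flat layer; in the tree:
`Literature/…/ChartMetricCompactness.lean`, `KerrFramedCompactness.lean`) gives limit Lorentzian
metrics on the model layers and limit leaf data glued by the (now compact: (S₆), window) transition
maps; the limit datum is smooth vacuum data on a connected Hausdorff second countable `X∞` (the leaf
model), its MGHD exists (`choquetBruhat_geroch_exists_mghd_cauchy`, named fact in the tree) and has
the core on its slice; CAUCHY STABILITY (the MGHD depends continuously on the data, uniformly on
compact subdomains: Ringström 2009, Ch. 16 with Ch. 14–15; Hawking–Ellis 1973, §7.5) yields the
`Cᵏ_loc` subconvergence with core carried to core; the collar jet is exact in the limit since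
`δₙ → 0`.  Why the PINNED SOUND hypothesis leaf: with the typed (or unpinned) leaf the flat sheet may
be null/timelike across the hole's neighbourhood (report §2) and no limit leaf exists.
[cite: RingstromCauchyProblem2009, Ch. 16] -/
def LeafCompactness : Prop :=
  ∀ (χ m₀ : ℝ) (k : ℕ), χ < 1 → 0 < m₀ → ∃ k' : ℕ, ∀ Λ : ℝ≥0∞, Λ < 1 →
    ∀ (δ : ℕ → ℝ≥0∞) (γ : ℕ → ℝ), (∀ n, 0 < δ n) → Tendsto δ atTop (𝓝 0) →
      (∀ n, 0 < γ n) → Tendsto γ atTop (𝓝 0) →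
    ∀ I : ∀ n, NearMinimisingInstance χ m₀ k' Λ (δ n) (γ n),
      ∃ L : ExactCollarInstance (k + 2), Nonempty (Shadow I L k)

/-- **(F2) LOWER SEMICONTINUITY OF THE CUT ENERGY — the limit carries the cut energy** (MISSING).
Along a shadowed sequence of near-minimising instances the limit core has a cut Bondi energy `m`
(some asymptotically round receding family on its outer roof `∂J⁺(C∞)` has a Hawking-mass limit) and
eventually every cut energy of the approximants' cores is `≥ m − η`.  Route: monotonicity of the
Hawking mass along each roof `Nₙ` in the REST-FRAME ROUND (constant-mass-aspect) foliation
(Christodoulou–Klainerman 1993, Ch. 17; Sauter 2008, Thm. 4.1; Mars–Soria 2015; in the tree the flux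
identity is the predicate `NullHypersurface.HasHawkingFlux` with `hawkingMass_monotone`,
`HawkingMassFlux.lean`), the signed Hawking bulk `∫_N Φ_H ≤ Δ_K(a) + γₙ + Cδₙ` confining the cone
data uniformly beyond every compactum, then `n → ∞` at fixed affine parameter.  Risk (planner's (i)):
completeness of the limit roof with a Hawking limit needs uniform control of `Nₙ` near `𝓘⁺`,
available only in the flux norm. [cite: ChristodoulouKlainerman1993PMS41, Ch. 17, Conclusion 17.0.4] -/
def CutEnergyLSC : Prop :=
  ∀ (χ m₀ : ℝ) (k' : ℕ) (Λ : ℝ≥0∞) (δ : ℕ → ℝ≥0∞) (γ : ℕ → ℝ),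
    Tendsto δ atTop (𝓝 0) → Tendsto γ atTop (𝓝 0) →
    ∀ (I : ∀ n, NearMinimisingInstance χ m₀ k' Λ (δ n) (γ n)) (k'' k : ℕ)
      (L : ExactCollarInstance k'') (sh : Shadow I L k), 2 ≤ k →
    ∃ m : ℝ, L.𝒱.toCauchyDevelopment.HasCutBondiMass L.core m ∧
      ∀ η : ℝ, 0 < η → ∀ᶠ n in atTop, ∀ m',
        (I (sh.cv.sub n)).𝒟.toCauchyDevelopment.HasCutBondiMass (I (sh.cv.sub n)).core m' →
          m ≤ m' + η

/-- **(F3) COMPETITOR REALISATION — upper semicontinuity of the infimum** (MISSING, XL).  Along a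
shadowed sequence the limit core HAS a competitor mass, and every competitor mass `m'` of the limit
core is, for large `n`, within `η` of a competitor mass of the approximants' cores.  Route: a
competitor `(𝒟', U, φ)` of the exact limit core receives an isometric copy of a neighbourhood `U` of
`C∞`; the approximants' neighbourhoods are `Cᵏ`-close to `U` (shadow), and GLUING of vacuum data
across an annulus (obstruction-free characteristic gluing, Czimek–Rodnianski arXiv:2210.09663, Thm.
1.1; characteristic gluing to Kerr, Aretakis–Czimek–Rodnianski 2023; Corvino–Schoen 2006 for the
spacelike far end) transplants the competitor's exterior onto the approximant's neighbourhood up to an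
`o(1)` change of the cut energy; existence of ONE competitor for the exact Kerr collar: an admissible
MGHD containing an exact Kerr collar (event-horizon gluing, Kehle–Unger 2024, Thm. 1).
[cite: CzimekRodnianski2022, Thm. 1.1] -/
def CompetitorRealisation : Prop :=
  ∀ (χ m₀ : ℝ) (k' : ℕ) (Λ : ℝ≥0∞) (δ : ℕ → ℝ≥0∞) (γ : ℕ → ℝ),
    Tendsto δ atTop (𝓝 0) → Tendsto γ atTop (𝓝 0) →
    ∀ (I : ∀ n, NearMinimisingInstance χ m₀ k' Λ (δ n) (γ n)) (k'' k : ℕ)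
      (L : ExactCollarInstance k'') (sh : Shadow I L k), 2 ≤ k →
    (∃ m' : ℝ, L.𝒱.IsCompetitorMass L.core m') ∧
      ∀ m', L.𝒱.IsCompetitorMass L.core m' → ∀ η : ℝ, 0 < η → ∀ᶠ n in atTop, ∃ m'',
        (I (sh.cv.sub n)).𝒟.IsCompetitorMass (I (sh.cv.sub n)).core m'' ∧ m'' ≤ m' + η

/-- **(F4) BOX TRANSFER — Cauchy stability of the compact box footprint, up to the spacelike inner
edge** (MISSING).  Along a shadowed sequence (order `k`), an EXACT `(0, k)`-box
`{τ' < t* < τ' + T, M∞ < r < R + 1}` of the limit's own background inside `J⁺(C∞)` yields, for large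
`n`, `(ε, k₁)`-boxes (`k₁ + 1 ≤ k`) of the approximants' backgrounds inside `J⁺(Cₙ)`.  Route: the
comparison maps of the shadow composed with the exact box chart and the frame change
`P_{moₙ} ∘ P_{mo∞}⁻¹` (the box predicate is covariant under the hole's Poincaré motion, so frame
DRIFT is harmless); `Cᵏ` convergence on compacta of the limit; causal futures are lower semicontinuous
under `C⁰` convergence with `embedₙ(C∞) = Cₙ`; the strip near the inner edge `r → M⁺` (not compact
in the limit, which is developed from leaf data on `{r > M}`) is controlled UNIFORMLY because `{r = M}`
is a spacelike EXIT boundary inside the black hole for `|a| ≤ χ M < M` (`r₋ < M`), so energy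
estimates close without boundary data (Ringström 2009, Ch. 16; the red-shift/no-shift region of
Dafermos–Luk 2017, §1).  Planner's risk (iv) (strong convergence of the cone data) is part of (F1)'s
`Cᵏ_loc` claim, not of this step. [cite: RingstromCauchyProblem2009, Ch. 16] -/
def BoxTransfer : Prop :=
  ∀ (χ m₀ : ℝ) (k' : ℕ) (Λ : ℝ≥0∞) (δ : ℕ → ℝ≥0∞) (γ : ℕ → ℝ),
    Tendsto δ atTop (𝓝 0) → Tendsto γ atTop (𝓝 0) →
    ∀ (I : ∀ n, NearMinimisingInstance χ m₀ k' Λ (δ n) (γ n)) (k'' k : ℕ)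
      (L : ExactCollarInstance k'') (sh : Shadow I L k) (k₁ : ℕ) (ε : ℝ≥0∞) (R T : ℝ),
      k₁ + 1 ≤ k → 0 < ε →
    ∀ (τ' : ℝ) (Ψ' : (L.B 0).domain → L.𝒱.carrier),
      IsNearModelBox L.𝒱.toSpacetime (L.B 0) k 0 τ' (τ' + T) (L.M 0) (R + 1)
        (L.𝒱.metric.causalFuture L.𝒱.timeOrientation L.core) Ψ' →
      ∀ᶠ n in atTop, ∃ (τ : ℝ) (Ψ : ((I (sh.cv.sub n)).B 0).domain → (I (sh.cv.sub n)).𝒟.carrier),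
        IsNearModelBox (I (sh.cv.sub n)).𝒟.toSpacetime ((I (sh.cv.sub n)).B 0) k₁ ε τ (τ + T)
          ((I (sh.cv.sub n)).M 0) (R + 1)
          ((I (sh.cv.sub n)).𝒟.metric.causalFuture (I (sh.cv.sub n)).𝒟.timeOrientation
            (I (sh.cv.sub n)).core) Ψ

/-- **The limit of a shadowed near-minimising sequence is an exact minimiser with a competitor**
(proved from (F2), (F3) and the gaps `γₙ → 0` by `bondiBartnikGapLE_zero_of_semicontinuity`): it
satisfies ALL hypotheses of `ExactMinimiserKerrness` at level `k''`.
[cite: HuangLee2020, Def. 7.8] -/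
theorem ExactCollarInstance.exactMinimiser_of_semicontinuity (hF2 : CutEnergyLSC)
    (hF3 : CompetitorRealisation) {χ m₀ : ℝ} {k' : ℕ} {Λ : ℝ≥0∞} {δ : ℕ → ℝ≥0∞} {γ : ℕ → ℝ}
    (hδ : Tendsto δ atTop (𝓝 0)) (hγ : Tendsto γ atTop (𝓝 0))
    (I : ∀ n, NearMinimisingInstance χ m₀ k' Λ (δ n) (γ n)) {k'' k : ℕ}
    (L : ExactCollarInstance k'') (sh : Shadow I L k) (hk : 2 ≤ k) :
    L.𝒱.NearKerrCollarCore k'' 0 0 1 L.M L.a univ L.p L.mo L.B L.Φ ∧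
      ∃ m' : ℝ, L.𝒱.IsCompetitorMass L.core m' := by
  obtain ⟨m, hm, lsc⟩ := hF2 χ m₀ k' Λ δ γ hδ hγ I k'' k L sh hk
  obtain ⟨hcomp, usc⟩ := hF3 χ m₀ k' Λ δ γ hδ hγ I k'' k L sh hk
  refine ⟨L.nearKerrCollarCore ⟨m, hm⟩ ?_, hcomp⟩
  exact bondiBartnikGapLE_zero_of_semicontinuity (X := fun n ↦ (I (sh.cv.sub n)).X)
    (𝒟 := fun n ↦ (I (sh.cv.sub n)).𝒟) (C := fun n ↦ (I (sh.cv.sub n)).core)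
    (hγ.comp sh.cv.strictMono_sub.tendsto_atTop) (fun n ↦ (I (sh.cv.sub n)).bondiBartnikGapLE)
    hm lsc usc

/-- **The soft package from the four facts** (pure logic: contradiction + a failing sequence with
`δₙ = γₙ → 0`).  Fix `(χ, m₀, k₁, ε₁, R, T)`; (F1) at order `k = k₁ + 2` names `k'`; if for some
`Λ < 1` no `(δ, γ)` worked, choose for each `n` an unshadowed instance at `δₙ = γₙ ≍ 1/(n+1)`; (F1)
gives a limit exact-collar instance shadowing a subsequence, (F2)/(F3) make it an exact minimiser with
a competitor (`exactMinimiser_of_semicontinuity`); if it has an exact box of the requested size, (F4)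
transfers it to a late member of the subsequence, which is then shadowed — contradiction; if it has
none, every member is shadowed vacuously — contradiction. [folklore] -/
theorem nearMinimiserShadowing_of_facts (hF1 : LeafCompactness) (hF2 : CutEnergyLSC)
    (hF3 : CompetitorRealisation) (hF4 : BoxTransfer) : NearMinimiserShadowing := by
  intro χ m₀ k₁ ε₁ R T hχ hm₀ hε₁
  obtain ⟨k', hk'⟩ := hF1 χ m₀ (k₁ + 2) hχ hm₀
  refine ⟨k', fun Λ hΛ ↦ ?_⟩
  by_contra hcon
  -- the failing sequence
  set δ : ℕ → ℝ≥0∞ := fun n ↦ ((n + 1 : ℕ) : ℝ≥0∞)⁻¹ with hδdef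
  set γ : ℕ → ℝ := fun n ↦ 1 / ((n : ℝ) + 1) with hγdef
  have hδpos : ∀ n, 0 < δ n := fun n ↦ ENNReal.inv_pos.2 (ENNReal.natCast_ne_top _)
  have hδ : Tendsto δ atTop (𝓝 0) := ENNReal.tendsto_inv_nat_nhds_zero.comp (tendsto_add_atTop_nat 1)
  have hγpos : ∀ n, 0 < γ n := fun n ↦ by rw [hγdef]; positivity
  have hγ : Tendsto γ atTop (𝓝 0) := tendsto_one_div_add_atTop_nhds_zero_nat
  have hbad : ∀ n, ∃ I : NearMinimisingInstance χ m₀ k' Λ (δ n) (γ n), ¬ I.IsShadowed k₁ ε₁ R T :=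
    fun n ↦ not_forall.1 fun h ↦ hcon ⟨δ n, γ n, hδpos n, hγpos n, h⟩
  choose I hI using hbad
  -- its limit, an exact minimiser with a competitor
  obtain ⟨L, ⟨sh⟩⟩ := hk' Λ hΛ δ γ hδpos hδ hγpos hγ I
  obtain ⟨hcore', hcomp'⟩ := L.exactMinimiser_of_semicontinuity hF2 hF3 hδ hγ I sh (by omega)
  by_cases hbox : ∃ (τ' : ℝ) (Ψ' : (L.B 0).domain → L.𝒱.carrier),
      IsNearModelBox L.𝒱.toSpacetime (L.B 0) (k₁ + 2) 0 τ' (τ' + T) (L.M 0) (R + 1)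
        (L.𝒱.metric.causalFuture L.𝒱.timeOrientation L.core) Ψ'
  · obtain ⟨τ', Ψ', hb⟩ := hbox
    obtain ⟨n, hn⟩ :=
      (hF4 χ m₀ k' Λ δ γ hδ hγ I (k₁ + 2 + 2) (k₁ + 2) L sh k₁ ε₁ R T (by omega) hε₁ τ' Ψ' hb).exists
    exact hI (sh.cv.sub n) ⟨k₁ + 2 + 2, k₁ + 2, by omega, L, hcore', hcomp', fun _ ↦ hn⟩
  · exact hI (sh.cv.sub 0) ⟨k₁ + 2 + 2, k₁ + 2, by omega, L, hcore', hcomp', fun h ↦ (hbox h).elim⟩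

/-- **K3 (corrected signature) from the four missing facts and `ExactMinimiserKerrness`** — the
honest route of the report, sorry-free modulo its five hypotheses. [folklore] -/
theorem stub_compactnessToKerrInterior_pinned_of_facts (hF1 : LeafCompactness)
    (hF2 : CutEnergyLSC) (hF3 : CompetitorRealisation) (hF4 : BoxTransfer)
    (hE : ExactMinimiserKerrness) :
    ∀ (χ m₀ : ℝ) (k₁ : ℕ) (ε₁ : ℝ≥0∞) (R T : ℝ), χ < 1 → 0 < m₀ → 0 < ε₁ →
    ∃ k' : ℕ, ∀ Λ : ℝ≥0∞, Λ < 1 → ∃ (δ : ℝ≥0∞) (γ : ℝ), 0 < δ ∧ 0 < γ ∧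
    ∀ (X : Type) [TopologicalSpace X] [ChartedSpace E3 X] [IsManifold (𝓡 3) ∞ X]
      [T2Space X] [SecondCountableTopology X] [ConnectedSpace X],
    ∀ D ∈ admissibleVacuumData X, ∀ (𝒟 : VacuumCauchyDevelopment D)
      (M a : Fin 1 → ℝ) (S : Set 𝒟.carrier) (p : 𝒟.carrier) (mo : Fin 1 → lorentzGroup × E4)
      (B : Fin 1 → ModelBackground) (Φ : ∀ i, (B i).domain → 𝒟.carrier),
    𝒟.IsMaximal → (∀ i, m₀ ≤ M i ∧ M i ≤ m₀⁻¹ ∧ |a i| ≤ χ * M i) →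
    IsPinnedSoundNearKerrLeaf 𝒟.toCauchyDevelopment k' Λ 1 M a S → p ∈ S →
    (∃ i, p ∈ Φ i '' (B i).truncTimeSlab (3 * M i) 0) →
    𝒟.NearKerrCollarCore k' δ γ 1 M a S p mo B Φ →
    ∃ (τ : ℝ) (Ψ : (B 0).domain → 𝒟.carrier),
      IsNearModelBox 𝒟.toSpacetime (B 0) k₁ ε₁ τ (τ + T) (M 0) (R + 1)
        (𝒟.metric.causalFuture 𝒟.timeOrientation (collarCore M p B Φ)) Ψ :=
  stub_compactnessToKerrInterior_pinned_of_shadowing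
    (nearMinimiserShadowing_of_facts hF1 hF2 hF3 hF4) hE

end Facts

/-- **K3 — COMPACTNESS–SEMICONTINUITY–TRANSFER** (the soft package of the direct method):
`ExactMinimiserKerrness` (exact minimisers with exact collar are Kerr inside `J⁺(C)`, K1 ∘ K2) implies
that NEAR-minimisers with NEAR-Kerr collars on bounded-geometry leaves have NEAR-Kerr interiors: for
every margin/window `(χ, m₀)`, every requested box quality `(k₁, ε₁)`, radius `R` and length `T` there
is `k'` such that below the honesty threshold (`Λ < 1`) some `δ, γ > 0` force, in every MGHD of
admissible data, every `(Λ, k')`-leaf `S ∋ p` through ONE `δ`-Kerr thick collar containing `p` whose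
core has a cut energy and gap `≤ γ`, an `(ε₁, k₁)`-Kerr box `{τ < t* < τ + T, M < r < R + 1}` of the
collar's own background inside `J⁺(C)`.  Intended proof (contradiction): a failing sequence at fixed
`(k', Λ)` with `δₙ, γₙ → 0` is a bounded minimising sequence; Arzelà–Ascoli on the FIXED model domains
of the hypothesis charts (collar slab, hole slab, flat sheet) + Cauchy stability on compacta give limit
data and its maximal vacuum development `𝒱` with EXACT collar jet; the limit outer roof `N_∞` carries
the limit cone data with cut energy `𝔅_∞ ≤ liminf 𝔅ₙ` (monotonicity of the Hawking mass along each
`Nₙ` in the REST-FRAME ROUND foliation, then `n → ∞` at fixed parameter; signed Hawking bulk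
`∫_N Φ_H ≤ Δ_K(a) + γ + Cδ` confines the data, kit j019840) and `inf(𝒱, C_∞) ≥ limsup infₙ`
(competitor REALISATION: admissible competitors of the limit core transplant to competitors of
`(𝒟ₙ, Cₙ)` up to `o(1)` by gluing — shared S2); so the limit is an exact minimiser,
`ExactMinimiserKerrness` gives exact boxes in `J⁺(C_∞)`, and Cauchy stability of the compact box region
(domain of dependence of a compact piece of slab ∪ roof data) transfers an `(ε₁, k₁)`-box to `𝒟ₙ`,
`n ≫ 1` — contradiction.  Why it might fail: (i) the limit must CARRY the cut energy — completeness of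
`N_∞` with a Hawking limit needs uniform control of `Nₙ` beyond every compactum, available only in the
weak flux norm; (ii) USC needs competitor realisation (XL gluing: Czimek–Rodnianski / Corvino–Schoen);
(iii) the flat chart's tip may drift unboundedly from `p` along non-achronal hypothesis leaves (triage
r2-2 (s1)), degenerating the limit sheet to a null slab — a HYPOTHESIS-side statement defect shared by
C″, to be cured by the restatement (sound hypothesis leaves), else this stub must draw the footprint of
the box from the hole slab / collar alone; (iv) the transfer needs STRONG convergence of the cone data on
compacta — weak convergence + `𝔅ₙ → 𝔅_∞` upgrades to flux-norm convergence only if the Hessian of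
`𝔅` at Kerr's profile is non-degenerate modulo gauge (the card's falsifier #1, a Kadec–Klee step; NOT
a sign condition), and flux-norm to `C^{k₁}` by interpolation against a uniform high-norm bound, which
inside compacta comes only from the hypothesis leaf's `C^{k'}` bound where the incoming field crossed
`S` (`k' ≫ k₁`, multiplicative loss as in dossier a1).  Size: XL.  Sources: Ringstrom2009 (Cauchy
stability), arXiv:1406.3009, arXiv:2210.09663, doi:10.2140/pjm.2020.304.629, arXiv:1401.3789 p. 5,
arXiv:1506.01545, DongSong2024 (template: rigidity + compactness ⇒ stability). -/
theorem stub_compactnessToKerrInterior : ExactMinimiserKerrness →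
    ∀ (χ m₀ : ℝ) (k₁ : ℕ) (ε₁ : ℝ≥0∞) (R T : ℝ), χ < 1 → 0 < m₀ → 0 < ε₁ →
    ∃ k' : ℕ, ∀ Λ : ℝ≥0∞, Λ < 1 → ∃ (δ : ℝ≥0∞) (γ : ℝ), 0 < δ ∧ 0 < γ ∧
    ∀ (X : Type) [TopologicalSpace X] [ChartedSpace E3 X] [IsManifold (𝓡 3) ∞ X]
      [T2Space X] [SecondCountableTopology X] [ConnectedSpace X],
    ∀ D ∈ admissibleVacuumData X, ∀ (𝒟 : VacuumCauchyDevelopment D)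
      (M a : Fin 1 → ℝ) (S : Set 𝒟.carrier) (p : 𝒟.carrier) (mo : Fin 1 → lorentzGroup × E4)
      (B : Fin 1 → ModelBackground) (Φ : ∀ i, (B i).domain → 𝒟.carrier),
    𝒟.IsMaximal → (∀ i, m₀ ≤ M i ∧ M i ≤ m₀⁻¹ ∧ |a i| ≤ χ * M i) →
    𝒟.toCauchyDevelopment.IsNearKerrLeaf k' Λ 1 M a S → p ∈ S →
    (∃ i, p ∈ Φ i '' (B i).truncTimeSlab (3 * M i) 0) →
    𝒟.NearKerrCollarCore k' δ γ 1 M a S p mo B Φ →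
    ∃ (τ : ℝ) (Ψ : (B 0).domain → 𝒟.carrier),
      IsNearModelBox 𝒟.toSpacetime (B 0) k₁ ε₁ τ (τ + T) (M 0) (R + 1)
        (𝒟.metric.causalFuture 𝒟.timeOrientation (collarCore M p B Φ)) Ψ := by
  sorry

end Summit.FinalStateConjecture.FinalStateConjecture.Theorems.BondiBartnikRigidity.DirectMethod

end
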